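import Mathlib.GroupTheory.Perm.Cycle.Concrete
import Mathlib.GroupTheory.Perm.Cycle.Type
import Mathlib.Algebra.BigOperators.Group.Finset.Basic

/-!
# Route `KPlusLogSqLaw`, crux `TropicalB` — SINGLE-CYCLE PAIRWISE QUOTIENTS: `p·q + 1` permutations of `p + q + 1` nodes all of whose
# pairwise quotients are ONE cycle (the sector of the pairwise exchange law where it is vacuous is at least quadratic)

HONEST FRAMING.  Helper file (STRUCTURE of the pairwise-quotient calculus) toward the registered stubs `stub_tropThin` / `stub_tropFat`
of `Cruxes/TropicalB/Lines/birth.lean` (crux `Summit.ValiantsHypothesis.ValiantsHypothesis.Theses.KPlusLogSqLaw.TropicalB`, ledger item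
`stmt-ValiantsHypothesis-19771`, route `KPlusLogSqLaw`; cell `pub-symmetroid`, seat val-sym-trop-p1 g29, 2026-08-29; `--supports … --as helper`).
A purely combinatorial fact about permutations; nothing here bounds `TropicalB`, and nothing bears on `WeakLifting`, the doors,
`MatrixDescartes` (stmt-ValiantsHypothesis-18050) or `VP ≠ VNP`.

THE SETTING.  Every valuation-free law the cell has for dominant chains speaks about the PAIRWISE QUOTIENTS `σᵢ⁻¹ σⱼ` of the chain's
permutations: cyclewise monotonicity (`…TropicalCycleMonotone`: the exponent mass rises on every invariant column block on which the two
terms differ, i.e. on every union of cycles of the quotient), its three-term corollary the expiration property (`…TropicalBExpirationProperty`),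
and the cycle-potential laws (`…TropicalBCyclePotential*`, quotients with orbits `≤ c`).  When `σᵢ⁻¹ σⱼ` is a SINGLE cycle (all other columns
fixed), the only invariant blocks on which two STATIC terms differ contain that whole cycle, so the pairwise law asks for nothing but «the
total slope rises» — which slope order gives for free.  The refuter-adjacent memo HOME/val-sym-trop-p5/g19/EXPIRATION-PROXY-g19.md §2(d)
located the maximal size of such families («PSC»: all pairwise quotients a single cycle) as `6, 6, 13, ≥ 18` at `m = 3..6` and read «single-block
entanglement cannot carry more than ~3m terms».  This file puts the opposite in the kernel: PSC families are at least QUADRATIC in `m`.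

THE THEOREM (`exists_singleCycleQuotients`).  For all `p, q` the `p·q + 1` permutations of `Fin (p + q + 1)` consisting of the identity and the
3-cycles `(0 aᵢ bⱼ) = swap 0 aᵢ * swap aᵢ bⱼ` with `aᵢ = i + 1` (`i < p`) and `bⱼ = p + 1 + j` (`j < q`) are pairwise distinct, and EVERY pairwise
quotient `σ⁻¹ τ` is a cycle (`Equiv.Perm.IsCycle`: one non-trivial orbit).  With `p = ⌊(m−1)/2⌋`, `q = ⌈(m−1)/2⌉` that is `⌊(m−1)²/4⌋ + 1`
permutations of `m` nodes (`43 > 3·14` at `m = 14`; every `m ≥ 1` is of the form `p + q + 1`).  The three quotient types between 3-cycles are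
`(0 a b)⁻¹(0 a b') = (a b b')` (`quotient_sameLeft`), `(0 a b)⁻¹(0 a' b) = (0 a' a)` (`quotient_sameRight`) and, for five distinct letters, the
5-cycle `(0 a b)⁻¹(0 a' b') = (0 a' b' b a)` (`quotient_disjoint`, as `List.formPerm [0, a', b', b, a]`); a shared MIDDLE letter (`b = a'`) would
give two 2-cycles, which the bipartition of the letters into `a`'s and `b`'s excludes.  So single-cycle quotients alone do not cap a chain below
`m²/4`; whether PSC families are `O(m²)` (which would make single-cycle designs harmless for the crux) is open here.  The seat's memo
HOME/val-sym-trop-p1/g29/PAIRWISE-ODOMETERS-g29.md records the companion located facts (static two- and three-digit odometer families with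
single-cycle pairwise quotients on `2r+2` resp. `(r+1)²+2r+3` nodes, and why register architectures need more than the pairwise law gives).
[folklore] (products of transpositions); the packaging and its use are the cell's.
-/

set_option linter.dupNamespace false
set_option autoImplicit false

namespace Summit.ValiantsHypothesis.ValiantsHypothesis.Theorems.KPlusLogSqLaw.SingleCycleQuotients

open Equiv Equiv.Perm

variable {α : Type*} [DecidableEq α]

/-- The 3-cycle `(o a b) = swap o a * swap a b` is a cycle. [folklore] -/
theorem isCycle_threeCycle [Fintype α] {o a b : α} (hoa : o ≠ a) (hob : o ≠ b) (hab : a ≠ b) :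
    IsCycle (swap o a * swap a b) := by
  rw [swap_comm o a]
  exact (isThreeCycle_swap_mul_swap_same hoa.symm hab hob).isCycle

/-- Inverse of the 3-cycle `(o a b)`. [folklore] -/
theorem threeCycle_inv (o a b : α) : (swap o a * swap a b)⁻¹ = swap a b * swap o a := by
  rw [mul_inv_rev, swap_inv, swap_inv]

/-- **Same left letter**: `(o a b)⁻¹ (o a b') = (a b b')`, a product of two swaps sharing `a`. [folklore] -/
theorem quotient_sameLeft (o a b b' : α) :
    (swap o a * swap a b)⁻¹ * (swap o a * swap a b') = swap a b * swap a b' := by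
  rw [threeCycle_inv, mul_assoc, ← mul_assoc (swap o a), swap_mul_self, one_mul]

/-- the same-left quotient is a cycle when `b ≠ b'`. [folklore] -/
theorem isCycle_quotient_sameLeft [Fintype α] {o a b b' : α} (hab : a ≠ b) (hab' : a ≠ b') (hbb' : b ≠ b') :
    IsCycle ((swap o a * swap a b)⁻¹ * (swap o a * swap a b')) := by
  rw [quotient_sameLeft]
  exact (isThreeCycle_swap_mul_swap_same hab hab' hbb').isCycle

/-- **Same right letter**: `(o a b)⁻¹ (o a' b) = (o a' a)`. [folklore] -/
theorem quotient_sameRight {o a a' b : α} (hoa : o ≠ a) (hob : o ≠ b) (hab : a ≠ b) (hoa' : o ≠ a') (ha'b : a' ≠ b)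
    (haa' : a ≠ a') :
    (swap o a * swap a b)⁻¹ * (swap o a' * swap a' b) = swap o a' * swap a' a := by
  rw [threeCycle_inv]
  ext x
  simp only [Perm.coe_mul, Function.comp_apply, swap_apply_def]
  split_ifs <;> simp_all

/-- the same-right quotient is a cycle. [folklore] -/
theorem isCycle_quotient_sameRight [Fintype α] {o a a' b : α} (hoa : o ≠ a) (hob : o ≠ b) (hab : a ≠ b) (hoa' : o ≠ a') (ha'b : a' ≠ b)
    (haa' : a ≠ a') : IsCycle ((swap o a * swap a b)⁻¹ * (swap o a' * swap a' b)) := by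
  rw [quotient_sameRight hoa hob hab hoa' ha'b haa']
  exact isCycle_threeCycle hoa' hoa haa'.symm

/-- **Disjoint letters**: `(o a b)⁻¹ (o a' b')` is the 5-cycle `(o a' b' b a)` = `formPerm [o, a', b', b, a]` when the five letters are
distinct (six-fold case analysis on the argument, each branch a straight evaluation of the eight transpositions). [folklore] -/
theorem quotient_disjoint {o a b a' b' : α} (hoa : o ≠ a) (hob : o ≠ b) (hab : a ≠ b) (hoa' : o ≠ a') (hob' : o ≠ b')
    (ha'b' : a' ≠ b') (haa' : a ≠ a') (hab' : a ≠ b') (hba' : b ≠ a') (hbb' : b ≠ b') :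
    (swap o a * swap a b)⁻¹ * (swap o a' * swap a' b') = List.formPerm [o, a', b', b, a] := by
  rw [threeCycle_inv, List.formPerm_cons_cons, List.formPerm_cons_cons, List.formPerm_cons_cons, List.formPerm_pair]
  ext x
  simp only [Perm.coe_mul, Function.comp_apply]
  by_cases hxo : x = o
  · subst x
    rw [swap_apply_of_ne_of_ne hoa' hob', swap_apply_left o a', swap_apply_of_ne_of_ne hoa'.symm haa'.symm,
      swap_apply_of_ne_of_ne haa'.symm hba'.symm, swap_apply_of_ne_of_ne hob hoa, swap_apply_of_ne_of_ne hob' hob,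
      swap_apply_of_ne_of_ne hoa' hob', swap_apply_left o a']
  by_cases hxa : x = a
  · subst x
    rw [swap_apply_of_ne_of_ne haa' hab', swap_apply_of_ne_of_ne hoa.symm haa', swap_apply_right o a,
      swap_apply_of_ne_of_ne hoa hob, swap_apply_right b a, swap_apply_right b' b, swap_apply_right a' b',
      swap_apply_right o a']
  by_cases hxb : x = b
  · subst x
    rw [swap_apply_of_ne_of_ne hba' hbb', swap_apply_of_ne_of_ne hob.symm hba', swap_apply_of_ne_of_ne hob.symm hab.symm,
      swap_apply_right a b, swap_apply_left b a, swap_apply_of_ne_of_ne hab' hab, swap_apply_of_ne_of_ne haa' hab',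
      swap_apply_of_ne_of_ne hoa.symm haa']
  by_cases hxa' : x = a'
  · subst x
    rw [swap_apply_left a' b', swap_apply_of_ne_of_ne hob'.symm ha'b'.symm, swap_apply_of_ne_of_ne hob'.symm hab'.symm,
      swap_apply_of_ne_of_ne hab'.symm hbb'.symm, swap_apply_of_ne_of_ne hba'.symm haa'.symm,
      swap_apply_of_ne_of_ne ha'b' hba'.symm, swap_apply_left a' b', swap_apply_of_ne_of_ne hob'.symm ha'b'.symm]
  by_cases hxb' : x = b'
  · subst x
    rw [swap_apply_right a' b', swap_apply_right o a', swap_apply_left o a, swap_apply_left a b,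
      swap_apply_of_ne_of_ne hbb'.symm hab'.symm, swap_apply_left b' b, swap_apply_of_ne_of_ne hba' hbb',
      swap_apply_of_ne_of_ne hob.symm hba']
  · rw [swap_apply_of_ne_of_ne hxa' hxb', swap_apply_of_ne_of_ne hxo hxa', swap_apply_of_ne_of_ne hxo hxa,
      swap_apply_of_ne_of_ne hxa hxb, swap_apply_of_ne_of_ne hxb hxa, swap_apply_of_ne_of_ne hxb' hxb,
      swap_apply_of_ne_of_ne hxa' hxb', swap_apply_of_ne_of_ne hxo hxa']

/-- the disjoint quotient is a cycle. [folklore] -/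
theorem isCycle_quotient_disjoint [Fintype α] {o a b a' b' : α} (hoa : o ≠ a) (hob : o ≠ b) (hab : a ≠ b) (hoa' : o ≠ a') (hob' : o ≠ b')
    (ha'b' : a' ≠ b') (haa' : a ≠ a') (hab' : a ≠ b') (hba' : b ≠ a') (hbb' : b ≠ b') :
    IsCycle ((swap o a * swap a b)⁻¹ * (swap o a' * swap a' b')) := by
  rw [quotient_disjoint hoa hob hab hoa' hob' ha'b' haa' hab' hba' hbb']
  refine List.isCycle_formPerm ?_ (by simp)
  simp only [List.nodup_cons, List.mem_cons, List.not_mem_nil, or_false, not_or, List.nodup_nil, and_true,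
    not_false_eq_true]
  exact ⟨⟨hoa', hob', hob, hoa⟩, ⟨ha'b', hba'.symm, haa'.symm⟩, ⟨hbb'.symm, hab'.symm⟩, hab.symm⟩

/-! ## The quadratic family: the identity and the 3-cycles `(0, i+1, p+1+j)` of `Fin (p+q+1)` -/

/-- **Single-cycle pairwise quotients, quadratically many** (`p·q + 1` permutations of `p + q + 1` nodes): the identity together
with the 3-cycles `(0, aᵢ, bⱼ)`, `aᵢ = i + 1` (`i < p`), `bⱼ = p + 1 + j` (`j < q`), are pairwise distinct and every pairwise quotient
`σ⁻¹ τ` is a cycle.  With `p = ⌊(m−1)/2⌋, q = ⌈(m−1)/2⌉` this is `⌊(m−1)²/4⌋ + 1` permutations of `m` nodes. [folklore] -/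
theorem exists_singleCycleQuotients (p q : ℕ) :
    ∃ f : Option (Fin p × Fin q) → Equiv.Perm (Fin (p + q + 1)),
      Function.Injective f ∧ ∀ s t, s ≠ t → ((f s)⁻¹ * f t).IsCycle := by
  let z : Fin (p + q + 1) := ⟨0, by omega⟩
  let A : Fin p → Fin (p + q + 1) := fun i => ⟨i.1 + 1, by omega⟩
  let B : Fin q → Fin (p + q + 1) := fun j => ⟨p + 1 + j.1, by omega⟩
  have hzA : ∀ i, z ≠ A i := fun i h => by simp [z, A, Fin.ext_iff] at h
  have hzB : ∀ j, z ≠ B j := fun j h => by simp [z, B, Fin.ext_iff] at h; omega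
  have hAB : ∀ i j, A i ≠ B j := fun i j h => by simp [A, B, Fin.ext_iff] at h; omega
  have hAA : ∀ i i', A i = A i' → i = i' := fun i i' h => by
    simp [A, Fin.ext_iff] at h; exact Fin.ext h
  have hBB : ∀ j j', B j = B j' → j = j' := fun j j' h => by
    simp [B, Fin.ext_iff] at h; exact Fin.ext h
  let c : Fin p × Fin q → Equiv.Perm (Fin (p + q + 1)) := fun ij => swap z (A ij.1) * swap (A ij.1) (B ij.2)
  have hcz : ∀ ij, c ij z = A ij.1 := fun ij => by
    simp only [c, Perm.coe_mul, Function.comp_apply]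
    rw [swap_apply_of_ne_of_ne (hzA _) (hzB _), swap_apply_left]
  have hcA : ∀ ij, c ij (A ij.1) = B ij.2 := fun ij => by
    simp only [c, Perm.coe_mul, Function.comp_apply]
    rw [swap_apply_left, swap_apply_of_ne_of_ne (hzB _).symm (hAB _ _).symm]
  have hc1 : ∀ ij, c ij ≠ 1 := fun ij h => by
    have := hcz ij; rw [h, Perm.coe_one, id] at this; exact hzA _ this
  refine ⟨fun s => s.elim 1 c, ?_, ?_⟩
  · -- injectivity
    rintro (_ | ⟨i, j⟩) (_ | ⟨i', j'⟩) h
    · rfl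
    · exact absurd h.symm (hc1 _)
    · exact absurd h (hc1 _)
    · simp only [Option.elim] at h
      have hi : i = i' := hAA _ _ (by rw [← hcz (i, j), ← hcz (i', j'), h])
      subst hi
      have hj : j = j' := hBB _ _ (by rw [← hcA (i, j), ← hcA (i, j'), h])
      subst hj; rfl
  · -- single-cycle quotients
    rintro (_ | ⟨i, j⟩) (_ | ⟨i', j'⟩) hst
    · exact absurd rfl hst
    · simpa only [Option.elim, inv_one, one_mul] using isCycle_threeCycle (hzA i') (hzB j') (hAB i' j')
    · simpa only [Option.elim, mul_one] using (isCycle_threeCycle (hzA i) (hzB j) (hAB i j)).inv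
    · simp only [Option.elim]
      by_cases hi : i = i'
      · subst hi
        have hj : j ≠ j' := fun h => hst (by rw [h])
        exact isCycle_quotient_sameLeft (hAB i j) (hAB i j') (fun h => hj (hBB _ _ h))
      by_cases hj : j = j'
      · subst hj
        exact isCycle_quotient_sameRight (hzA i) (hzB j) (hAB i j) (hzA i') (hAB i' j) (fun h => hi (hAA _ _ h))
      · exact isCycle_quotient_disjoint (hzA i) (hzB j) (hAB i j) (hzA i') (hzB j') (hAB i' j') (fun h => hi (hAA _ _ h))
          (hAB i j') (Ne.symm (hAB i' j)) (fun h => hj (hBB _ _ h))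

/-- Cardinality bookkeeping: the index set has `p·q + 1` elements. [folklore] -/
theorem card_index (p q : ℕ) : Fintype.card (Option (Fin p × Fin q)) = p * q + 1 := by
  simp


/-! ## Why a single-cycle quotient makes the pairwise law vacuous (rev 2, appended)

For two STATIC terms `(σ, λ)`, `(σ', λ')` (same cell ⇒ same class: `σ b = σ' b → λ b = λ' b`) whose quotient `σ⁻¹ σ'` is a cycle, every
column set `B` invariant under the quotient on which the two terms differ contains the whole non-trivial orbit, and outside it the two terms
coincide; so the exponent mass gained on `B` equals the TOTAL slope gain.  Hence the cyclewise law of the tree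
(`…TropicalCycleMonotone.sum_d_lt_of_isDominant_invariant`: mass rises on every invariant block where the terms differ) holds for such a pair
as soon as the total slope rises — which slope order along a chain gives for free. -/

/-- invariance of a finite column set under a permutation passes to all its powers. [folklore] -/
theorem pow_mem_of_invariant {m : ℕ} (q : Equiv.Perm (Fin m)) (B : Finset (Fin m)) (hB : ∀ b ∈ B, q b ∈ B)
    (i : ℕ) {b : Fin m} (hb : b ∈ B) : (q ^ i) b ∈ B := by
  induction i with
  | zero => simpa using hb
  | succ i ih => rw [pow_succ', Perm.coe_mul, Function.comp_apply]; exact hB _ ih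

/-- **Single-cycle quotient ⇒ invariant blocks see the whole difference.**  Static terms `(σ, λ)`, `(σ', λ')` with `σ⁻¹ σ'` a cycle: for every
column set `B` invariant under the quotient and containing a column where the terms differ, the exponent mass gained on `B` is the total gain.
[folklore] -/
theorem partialGain_eq_totalGain_of_isCycle {m K : ℕ} (d : Fin K → ℕ) (σ σ' : Equiv.Perm (Fin m)) (cl cl' : Fin m → Fin K)
    (hstatic : ∀ b, σ b = σ' b → cl b = cl' b) (hcyc : (σ⁻¹ * σ').IsCycle)
    (B : Finset (Fin m)) (hB : ∀ b ∈ B, (σ⁻¹ * σ') b ∈ B) (hdiff : ∃ b ∈ B, σ b ≠ σ' b ∨ cl b ≠ cl' b) :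
    (∑ b ∈ B, (d (cl' b) : ℤ)) - ∑ b ∈ B, (d (cl b) : ℤ) = (∑ b, (d (cl' b) : ℤ)) - ∑ b, (d (cl b) : ℤ) := by
  classical
  set q := σ⁻¹ * σ' with hq
  -- a moved column inside `B`
  obtain ⟨b₀, hb₀B, hb₀⟩ := hdiff
  have hmoved : ∀ b, q b ≠ b ↔ σ b ≠ σ' b := by
    intro b
    rw [hq, Perm.coe_mul, Function.comp_apply, Ne, Perm.inv_eq_iff_eq, ne_comm]
  have hb₀q : q b₀ ≠ b₀ := by
    rcases hb₀ with h | h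
    · exact (hmoved b₀).2 h
    · exact (hmoved b₀).2 fun h' => h (hstatic b₀ h')
  -- the whole support of the cycle lies in `B`
  have hsupp : ∀ x, q x ≠ x → x ∈ B := by
    intro x hx
    obtain ⟨i, hi⟩ := hcyc.exists_pow_eq hb₀q hx
    rw [← hi]; exact pow_mem_of_invariant q B hB i hb₀B
  -- outside `B` the two terms coincide
  have hout : ∀ x ∈ Bᶜ, (d (cl' x) : ℤ) = d (cl x) := by
    intro x hx
    rw [Finset.mem_compl] at hx
    have hfix : q x = x := by
      by_contra h; exact hx (hsupp x h)
    have hσ : σ x = σ' x := by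
      by_contra h; exact ((hmoved x).2 h) hfix
    rw [hstatic x hσ]
  rw [← Finset.sum_add_sum_compl B (fun b => (d (cl' b) : ℤ)), ← Finset.sum_add_sum_compl B (fun b => (d (cl b) : ℤ)),
    Finset.sum_congr rfl hout]
  ring

/-- **Corollary (the pairwise law is slope order on such pairs).**  If moreover the total slope rises, then the exponent mass rises on EVERY
invariant column block on which the two static terms differ — the hypothesis shape of the tree's cyclewise monotonicity law. [folklore] -/
theorem partialGain_pos_of_isCycle {m K : ℕ} (d : Fin K → ℕ) (σ σ' : Equiv.Perm (Fin m)) (cl cl' : Fin m → Fin K)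
    (hstatic : ∀ b, σ b = σ' b → cl b = cl' b) (hcyc : (σ⁻¹ * σ').IsCycle)
    (hslope : (∑ b, (d (cl b) : ℤ)) < ∑ b, (d (cl' b) : ℤ))
    (B : Finset (Fin m)) (hB : ∀ b ∈ B, (σ⁻¹ * σ') b ∈ B) (hdiff : ∃ b ∈ B, σ b ≠ σ' b ∨ cl b ≠ cl' b) :
    (∑ b ∈ B, (d (cl b) : ℤ)) < ∑ b ∈ B, (d (cl' b) : ℤ) := by
  have h := partialGain_eq_totalGain_of_isCycle d σ σ' cl cl' hstatic hcyc B hB hdiff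
  omega

/-! ## Rev 3 (appended): the transpositions `(0 x)` join the family — `p·q + p + q + 1` permutations, maximal at `m = 8`

Adding all transpositions through `0` keeps every pairwise quotient a cycle: `(0 x)⁻¹(0 y) = (0 y x)`, `(0 a)⁻¹(0 a b) = (a b)`,
`(0 b)⁻¹(0 a b) = (0 a)`, and `(0 x)⁻¹(0 a b) = (0 a b x)` for `x ∉ {a, b}`.  So PSC families have at least `⌊(m−1)²/4⌋ + m` members on
`m` nodes (`20` at `m = 8`; located, seat memo §1: this family admits NO further compatible cycle at `m = 8`, and the located maxima are
`6, 13, 18, ≥ 23` at `m = 4..7` with Delsarte LP upper bounds `6, 15, 30, 78`). -/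

set_option maxHeartbeats 400000 in
/-- `(0 x)⁻¹ (0 a b) = (0 a b x)` as `formPerm [o, a, b, x]` when the four letters are distinct. [folklore] -/
theorem swap_quotient_threeCycle_disjoint {o a b x : α} (hoa : o ≠ a) (hob : o ≠ b) (hab : a ≠ b) (hox : o ≠ x) (hax : a ≠ x)
    (hbx : b ≠ x) : (swap o x)⁻¹ * (swap o a * swap a b) = List.formPerm [o, a, b, x] := by
  rw [swap_inv, List.formPerm_cons_cons, List.formPerm_cons_cons, List.formPerm_pair]
  ext y
  simp only [Perm.coe_mul, Function.comp_apply, swap_apply_def]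
  split_ifs <;> simp_all

/-- `(0 a)⁻¹ (0 a b) = (a b)`. [folklore] -/
theorem swap_quotient_threeCycle_left (o a b : α) : (swap o a)⁻¹ * (swap o a * swap a b) = swap a b := by
  rw [swap_inv, ← mul_assoc, swap_mul_self, one_mul]

/-- `(0 b)⁻¹ (0 a b) = (0 a)`. [folklore] -/
theorem swap_quotient_threeCycle_right {o a b : α} (hoa : o ≠ a) (hob : o ≠ b) (hab : a ≠ b) :
    (swap o b)⁻¹ * (swap o a * swap a b) = swap o a := by
  rw [swap_inv]
  ext y
  simp only [Perm.coe_mul, Function.comp_apply, swap_apply_def]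
  split_ifs <;> simp_all

/-- **The extended family** (`p·q + (p+q) + 1` permutations of `p + q + 1` nodes, all pairwise quotients cycles): the identity, the
transpositions `(0 x)` for every `x ≠ 0`, and the 3-cycles `(0 aᵢ bⱼ)`.  With `p = ⌊(m−1)/2⌋` this is `⌊(m−1)²/4⌋ + m` on `m` nodes. [folklore] -/
theorem exists_singleCycleQuotients' (p q : ℕ) :
    ∃ f : Option ((Fin p × Fin q) ⊕ Fin (p + q)) → Equiv.Perm (Fin (p + q + 1)),
      Function.Injective f ∧ ∀ s t, s ≠ t → ((f s)⁻¹ * f t).IsCycle := by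
  let z : Fin (p + q + 1) := ⟨0, by omega⟩
  let A : Fin p → Fin (p + q + 1) := fun i => ⟨i.1 + 1, by omega⟩
  let B : Fin q → Fin (p + q + 1) := fun j => ⟨p + 1 + j.1, by omega⟩
  let X : Fin (p + q) → Fin (p + q + 1) := fun k => ⟨k.1 + 1, by omega⟩
  have hzA : ∀ i, z ≠ A i := fun i h => by simp [z, A, Fin.ext_iff] at h
  have hzB : ∀ j, z ≠ B j := fun j h => by simp [z, B, Fin.ext_iff] at h; omega
  have hzX : ∀ k, z ≠ X k := fun k h => by simp [z, X, Fin.ext_iff] at h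
  have hAB : ∀ i j, A i ≠ B j := fun i j h => by simp [A, B, Fin.ext_iff] at h; omega
  have hAA : ∀ i i', A i = A i' → i = i' := fun i i' h => by
    simp [A, Fin.ext_iff] at h; exact Fin.ext h
  have hBB : ∀ j j', B j = B j' → j = j' := fun j j' h => by
    simp [B, Fin.ext_iff] at h; exact Fin.ext h
  have hXX : ∀ k k', X k = X k' → k = k' := fun k k' h => by
    simp [X, Fin.ext_iff] at h; exact Fin.ext h
  let c : Fin p × Fin q → Equiv.Perm (Fin (p + q + 1)) := fun ij => swap z (A ij.1) * swap (A ij.1) (B ij.2)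
  have hcz : ∀ ij, c ij z = A ij.1 := fun ij => by
    simp only [c, Perm.coe_mul, Function.comp_apply]
    rw [swap_apply_of_ne_of_ne (hzA _) (hzB _), swap_apply_left]
  have hcA : ∀ ij, c ij (A ij.1) = B ij.2 := fun ij => by
    simp only [c, Perm.coe_mul, Function.comp_apply]
    rw [swap_apply_left, swap_apply_of_ne_of_ne (hzB _).symm (hAB _ _).symm]
  have hc1 : ∀ ij, c ij ≠ 1 := fun ij h => by
    have := hcz ij; rw [h, Perm.coe_one, id] at this; exact hzA _ this
  have hs1 : ∀ k, swap z (X k) ≠ 1 := fun k h => by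
    have := congrArg (fun g : Equiv.Perm (Fin (p + q + 1)) => g z) h
    simp only [swap_apply_left, Perm.coe_one, id] at this; exact hzX k this.symm
  have hsc : ∀ k ij, swap z (X k) ≠ c ij := fun k ij h => by
    -- evaluate at `A i`: the transposition sends it to `z` or fixes it, the 3-cycle sends it to `B j`
    have h1 := congrArg (fun g : Equiv.Perm (Fin (p + q + 1)) => g (A ij.1)) h
    simp only [hcA] at h1
    rcases eq_or_ne (X k) (A ij.1) with hk | hk
    · rw [hk, swap_apply_right] at h1; exact hzB _ h1
    · rw [swap_apply_of_ne_of_ne (hzA _).symm hk.symm] at h1; exact hAB _ _ h1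
  let F : Option ((Fin p × Fin q) ⊕ Fin (p + q)) → Equiv.Perm (Fin (p + q + 1)) :=
    fun s => s.elim 1 (fun u => u.elim c (fun k => swap z (X k)))
  refine ⟨F, ?_, ?_⟩
  · rintro (_ | ⟨⟨i, j⟩ | k⟩) (_ | ⟨⟨i', j'⟩ | k'⟩) h <;> simp only [F, Option.elim, Sum.elim_inl, Sum.elim_inr] at h
    · rfl
    · exact absurd h.symm (hc1 _)
    · exact absurd h.symm (hs1 _)
    · exact absurd h (hc1 _)
    · have hi : i = i' := hAA _ _ (by rw [← hcz (i, j), ← hcz (i', j'), h])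
      subst hi
      have hj : j = j' := hBB _ _ (by rw [← hcA (i, j), ← hcA (i, j'), h])
      subst hj; rfl
    · exact absurd h.symm (hsc _ _)
    · exact absurd h (hs1 _)
    · exact absurd h (hsc _ _)
    · have := congrArg (fun g : Equiv.Perm (Fin (p + q + 1)) => g z) h
      simp only [swap_apply_left] at this
      rw [hXX _ _ this]
  · rintro (_ | ⟨⟨i, j⟩ | k⟩) (_ | ⟨⟨i', j'⟩ | k'⟩) hst <;> simp only [F, Option.elim, Sum.elim_inl, Sum.elim_inr]
    · exact absurd rfl hst
    · simpa only [inv_one, one_mul] using isCycle_threeCycle (hzA i') (hzB j') (hAB i' j')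
    · simpa only [inv_one, one_mul] using isCycle_swap (hzX k')
    · simpa only [mul_one] using (isCycle_threeCycle (hzA i) (hzB j) (hAB i j)).inv
    · by_cases hi : i = i'
      · subst hi
        have hj : j ≠ j' := fun h => hst (by rw [h])
        exact isCycle_quotient_sameLeft (hAB i j) (hAB i j') (fun h => hj (hBB _ _ h))
      by_cases hj : j = j'
      · subst hj
        exact isCycle_quotient_sameRight (hzA i) (hzB j) (hAB i j) (hzA i') (hAB i' j) (fun h => hi (hAA _ _ h))
      · exact isCycle_quotient_disjoint (hzA i) (hzB j) (hAB i j) (hzA i') (hzB j') (hAB i' j') (fun h => hi (hAA _ _ h))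
          (hAB i j') (Ne.symm (hAB i' j)) (fun h => hj (hBB _ _ h))
    · -- 3-cycle then transposition: inverse of the transposition-then-3-cycle quotient
      have key : ((swap z (X k'))⁻¹ * c (i, j)).IsCycle := by
        rcases eq_or_ne (X k') (A i) with h1 | h1
        · rw [h1]; simpa only [c, swap_quotient_threeCycle_left] using isCycle_swap (hAB i j)
        rcases eq_or_ne (X k') (B j) with h2 | h2
        · rw [h2]; simp only [c]; rw [swap_quotient_threeCycle_right (hzA i) (hzB j) (hAB i j)]; exact isCycle_swap (hzA i)
        · simp only [c]
          rw [swap_quotient_threeCycle_disjoint (hzA i) (hzB j) (hAB i j) (hzX k') (Ne.symm h1) (Ne.symm h2)]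
          refine List.isCycle_formPerm ?_ (by simp)
          simp only [List.nodup_cons, List.mem_cons, List.not_mem_nil, or_false, not_or, List.nodup_nil, and_true,
            not_false_eq_true]
          exact ⟨⟨hzA i, hzB j, hzX k'⟩, ⟨hAB i j, Ne.symm h1⟩, Ne.symm h2⟩
      have := key.inv
      rwa [mul_inv_rev, inv_inv] at this
    · simpa only [mul_one] using (isCycle_swap (hzX k)).inv
    · rcases eq_or_ne (X k) (A i') with h1 | h1
      · rw [h1]; simpa only [c, swap_quotient_threeCycle_left] using isCycle_swap (hAB i' j')
      rcases eq_or_ne (X k) (B j') with h2 | h2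
      · rw [h2]; simp only [c]; rw [swap_quotient_threeCycle_right (hzA i') (hzB j') (hAB i' j')]; exact isCycle_swap (hzA i')
      · simp only [c]
        rw [swap_quotient_threeCycle_disjoint (hzA i') (hzB j') (hAB i' j') (hzX k) (Ne.symm h1) (Ne.symm h2)]
        refine List.isCycle_formPerm ?_ (by simp)
        simp only [List.nodup_cons, List.mem_cons, List.not_mem_nil, or_false, not_or, List.nodup_nil, and_true,
          not_false_eq_true]
        exact ⟨⟨hzA i', hzB j', hzX k⟩, ⟨hAB i' j', Ne.symm h1⟩, Ne.symm h2⟩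
    · have hk : k ≠ k' := fun h => hst (by rw [h])
      rw [swap_inv]
      exact (isThreeCycle_swap_mul_swap_same (hzX k) (hzX k') (fun h => hk (hXX _ _ h))).isCycle

/-- Cardinality bookkeeping for the extended family: `p·q + (p+q) + 1` members. [folklore] -/
theorem card_index' (p q : ℕ) : Fintype.card (Option ((Fin p × Fin q) ⊕ Fin (p + q))) = p * q + (p + q) + 1 := by
  simp

/-! ## Rev 4 (appended): the first necessary condition toward an upper bound — supports of PSC members pairwise INTERSECT -/

/-- **Supports intersect.**  If `σ` and `τ` are cycles with DISJOINT supports then `σ⁻¹ τ` is not a cycle (its cycle type has two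
entries); so in a family whose pairwise quotients are all cycles and which contains the identity, any two other members have intersecting
supports. [folklore] -/
theorem not_isCycle_quotient_of_disjoint [Fintype α] {σ τ : Equiv.Perm α} (hσ : σ.IsCycle) (hτ : τ.IsCycle)
    (h : Equiv.Perm.Disjoint σ τ) : ¬ (σ⁻¹ * τ).IsCycle := by
  intro hc
  have h1 : Multiset.card (σ⁻¹ * τ).cycleType = 1 := card_cycleType_eq_one.mpr hc
  rw [h.inv_left.cycleType_mul, Multiset.card_add, card_cycleType_eq_one.mpr (isCycle_inv.mpr hσ),
    card_cycleType_eq_one.mpr hτ] at h1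
  omega

end Summit.ValiantsHypothesis.ValiantsHypothesis.Theorems.KPlusLogSqLaw.SingleCycleQuotients
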